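import Mathlib
import HarnessLib

/-!
# Dense subsets of a product group from density at the first factor ("approximation ⇒ `Γ · G_f` is dense")

Topic `Topology/Algebra`; namespace `Literature.Topology.Algebra.DenseOrbit`.

The topological mechanism behind "`𝐆(F) · 𝐆(𝔸_f)` is dense in `𝐆(𝔸)` when `𝐆(F)` is dense in `𝐆(F ⊗ ℝ)`"
(real approximation ⇒ density of rational-times-finite-adelic points; e.g. V. Platonov, A. Rapinchuk, *Algebraic
Groups and Number Theory* (1994), §7.1, and J. Getz, H. Hahn, *An Introduction to Automorphic Representations*
(2024), §2.5), in kernel form and full generality: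

§1 (product form) for ANY product `A × B` of a topological monoid and a topological group and ANY subset
`Γ ⊆ A × B` whose first projection is dense: `Γ · ({1} × B)` is ALL of `(pr₁ Γ) × B` (`mul_one_prod_eq`), hence
dense (`dense_mul_one_prod`), and so is every larger set `Γ · ι(T) · ({1} × B)` with `1 ∈ ι(T)`
(`dense_mul_mid_mul_one_prod`).

§2 (dictionary form) for a topological group `G` with an isomorphism `e : G ≃ₜ* G∞ × Gf`, the inclusion
`ιf : Gf →* G` of the second factor and a subgroup `Γ ≤ G` whose first components are dense in `G∞`
(`DenseRange fun γ : Γ => (e γ).1`): `Γ · ιA(TA) · ιf(Gf)` is dense in `G` for every family `ιA : TA → G` with `TA`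
inhabited (`dense_of_denseRange_fst`, `dense_of_dense_image_fst`); and the transport of an ambient-space
approximation statement `range val ⊆ closure (range ρ)` (an inducing realisation `val : G∞ → M`, rational points
`ρ`) into that hypothesis (`denseRange_codRestrict_iff`, `denseRange_fst_of_isInducing`, `dense_of_realApproximation`).

Everything is elementary point-set topology [folklore]; Mathlib only.

## Provenance

Reproduced for the tree under the LEAN-IN-TREE rule (2026-08-18) from the pub-hodgecm cell's package files
`HodgeCM/PerL34/DenseProduct.lean` (seat pv06 generation 0, gate run 21; 60 lines, namespace
`HodgeCM.PerL34.DenseProduct`) and `HodgeCM/PerL34/DenseOrbit.lean` (seat pv06 generation 2, gate run 23; 133 lines,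
namespace `HodgeCM.PerL34.DenseOrbit`), verbatim up to the namespaces (merged) and the docstrings; nothing cited as
a hypothesis, nothing posited.
-/

set_option autoImplicit false

open Topology Function Set

namespace Literature.Topology.Algebra

namespace DenseOrbit

/-! ## §1 Product form -/

section ProductForm

variable {A B : Type*} [Monoid A] [Group B]

/-- `Γ · ({1} × B) = (pr₁ Γ) × B` for any subset `Γ` of a product of a monoid and a group. [folklore] -/
theorem mul_one_prod_eq (Γ : Set (A × B)) :
    {g : A × B | ∃ γ ∈ Γ, ∃ b : B, g = γ * (1, b)} = (Prod.fst '' Γ) ×ˢ (Set.univ : Set B) := by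
  ext ⟨a, y⟩
  constructor
  · rintro ⟨γ, hγ, b, h⟩
    refine ⟨⟨γ, hγ, ?_⟩, Set.mem_univ _⟩
    have := congrArg Prod.fst h
    simpa using this.symm
  · rintro ⟨⟨γ, hγ, rfl⟩, -⟩
    refine ⟨γ, hγ, γ.2⁻¹ * y, ?_⟩
    ext <;> simp

variable [TopologicalSpace A] [TopologicalSpace B]

/-- If `pr₁ Γ` is dense in `A` then `Γ · ({1} × B)` is dense in `A × B`. [folklore] -/
theorem dense_mul_one_prod (Γ : Set (A × B)) (hΓ : Dense (Prod.fst '' Γ)) :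
    Dense {g : A × B | ∃ γ ∈ Γ, ∃ b : B, g = γ * (1, b)} := by
  rw [mul_one_prod_eq]
  exact hΓ.prod dense_univ

/-- With a middle factor `ι(T) ∋ 1`: `Γ · ι(T) · ({1} × B)` is dense as soon as `pr₁ Γ` is. [folklore] -/
theorem dense_mul_mid_mul_one_prod (Γ : Set (A × B)) (hΓ : Dense (Prod.fst '' Γ))
    {T : Type*} (ι : T → A × B) (t₀ : T) (ht₀ : ι t₀ = 1) :
    Dense {g : A × B | ∃ γ ∈ Γ, ∃ (t : T) (b : B), g = γ * ι t * (1, b)} := by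
  refine (dense_mul_one_prod Γ hΓ).mono ?_
  rintro g ⟨γ, hγ, b, rfl⟩
  exact ⟨γ, hγ, t₀, b, by rw [ht₀, mul_one]⟩

end ProductForm

/-! ## §2 Dictionary form -/

section Dictionary

variable {G Ginf Gf : Type*} [Group G] [TopologicalSpace G]
  [Group Ginf] [TopologicalSpace Ginf] [ContinuousMul Ginf] [Group Gf] [TopologicalSpace Gf]

/-- **Density from approximation at the first factor.**  If `G ≅ G∞ × Gf` as topological groups, `ιf` is the
inclusion of the second factor, and the first components of a subgroup `Γ ≤ G` are dense in `G∞` (for an adelic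
group `G = 𝐆(𝔸) ≅ 𝐆(F ⊗ ℝ) × 𝐆(𝔸_f)` and `Γ = 𝐆(F)`: real approximation), then for any family `ιA : TA → G` with
`TA` inhabited, `Γ · ιA(TA) · ιf(Gf)` is dense in `G` ("given `(x_∞, x_f)`, approximate `x_∞` by `γ ∈ Γ`; then
`γ · ιf(γ_f⁻¹ x_f)` is close"). [folklore] -/
theorem dense_of_denseRange_fst (e : G ≃ₜ* Ginf × Gf) (Γ : Subgroup G) (ιf : Gf →* G)
    (hιf : ∀ k : Gf, e (ιf k) = (1, k))
    (hRA : DenseRange fun γ : Γ => (e γ).1)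
    {TA : Type*} (ιA : TA → G) (t₀ : TA) :
    Dense {g : G | ∃ γ ∈ Γ, ∃ (t : TA) (k : Gf), g = γ * ιA t * ιf k} := by
  set c : Ginf × Gf := e (ιA t₀) with hc
  -- the parametrisation `Φ (γ, k) = γ · ιA t₀ · ιf ((γ_f c_f)⁻¹ k)` of part of the set
  let Φ : Γ × Gf → G := fun p => (p.1 : G) * ιA t₀ * ιf (((e p.1).2 * c.2)⁻¹ * p.2)
  -- read through `e` it is `(γ, k) ↦ (γ_∞ c_∞, k)`, which has dense range
  have hΨ : DenseRange fun p : Γ × Gf => ((e p.1).1 * c.1, p.2) := by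
    have h1 : DenseRange fun γ : Γ => (e γ).1 * c.1 :=
      (Homeomorph.mulRight c.1).surjective.denseRange.comp hRA (Homeomorph.mulRight c.1).continuous
    exact h1.prodMap surjective_id.denseRange
  have heΦ : (fun p => e (Φ p)) = fun p : Γ × Gf => ((e p.1).1 * c.1, p.2) := by
    funext p
    simp only [Φ, map_mul, hιf, ← hc]
    ext
    · simp only [Prod.fst_mul, mul_one]
    · simp only [Prod.snd_mul, mul_inv_cancel_left]
  have hΦ : DenseRange Φ := by
    have h : DenseRange fun p => e.symm (e (Φ p)) :=
      (EquivLike.surjective e.symm).denseRange.comp (heΦ ▸ hΨ) (map_continuous e.symm)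
    simpa only [ContinuousMulEquiv.symm_apply_apply] using h
  refine Dense.mono ?_ hΦ
  rintro _ ⟨p, rfl⟩
  exact ⟨p.1, p.1.2, t₀, _, rfl⟩

/-- The same with the approximation hypothesis phrased as density of an image set: it suffices that the first
components of (some subset of) `Γ` be dense. [folklore] -/
theorem dense_of_dense_image_fst (e : G ≃ₜ* Ginf × Gf) (Γ : Subgroup G) (ιf : Gf →* G)
    (hιf : ∀ k : Gf, e (ιf k) = (1, k))
    (hRA : Dense ((fun g : G => (e g).1) '' (Γ : Set G)))
    {TA : Type*} (ιA : TA → G) (t₀ : TA) :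
    Dense {g : G | ∃ γ ∈ Γ, ∃ (t : TA) (k : Gf), g = γ * ιA t * ιf k} := by
  refine dense_of_denseRange_fst e Γ ιf hιf ?_ ιA t₀
  have hr : range (fun γ : Γ => (e γ).1) = (fun g : G => (e g).1) '' (Γ : Set G) := by
    ext x
    constructor
    · rintro ⟨γ, rfl⟩; exact ⟨γ, γ.2, rfl⟩
    · rintro ⟨g, hg, rfl⟩; exact ⟨⟨g, hg⟩, rfl⟩
  change Dense (range fun γ : Γ => (e γ).1)
  rw [hr]
  exact hRA

/-- Reading a closure statement in an ambient space (every point of a subset `S` lies in the closure of the range of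
`f`, whose values lie in `S`) as density of the `S`-valued corestriction — the form `hRA` above wants when `G∞` is
realised as a subspace `S` of an ambient space. [folklore] -/
theorem denseRange_codRestrict_iff {X ι : Type*} [TopologicalSpace X] {S : Set X} (f : ι → X)
    (h : ∀ i, f i ∈ S) : DenseRange (S.codRestrict f h) ↔ S ⊆ closure (range f) := by
  rw [DenseRange, Subtype.dense_iff, ← range_comp]
  rfl

omit [ContinuousMul Ginf] in
/-- TRANSPORT of an ambient-space approximation statement into the hypothesis `hRA` of `dense_of_denseRange_fst`.
Inputs: an inducing map `val` of `G∞` into an ambient space `M` (e.g. for a unitary group: families of complex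
matrices indexed by the archimedean places, `range val` = the unitary families), a family `ρ` of points of `M` each
of which is the first component of an element of `Γ` (the rational points), and the closure statement
`range val ⊆ closure (range ρ)` (the usual conclusion of a matrix-level real-approximation theorem, e.g. the tree's
`Literature.GroupTheory.ArithmeticGroups.*RealApproximation*`).  Output: `hRA`.  Only `IsInducing val` is used.
[folklore] -/
theorem denseRange_fst_of_isInducing (e : G ≃ₜ* Ginf × Gf) (Γ : Subgroup G)
    {M ΓQ : Type*} [TopologicalSpace M] (val : Ginf → M) (hval : Topology.IsInducing val)
    (ρ : ΓQ → M) (himg : ∀ q, ∃ γ ∈ Γ, val (e γ).1 = ρ q)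
    (hRAW : range val ⊆ closure (range ρ)) : DenseRange fun γ : Γ => (e γ).1 := by
  intro x
  have hsub : range ρ ⊆ val '' range (fun γ : Γ => (e γ).1) := by
    rintro _ ⟨q, rfl⟩
    obtain ⟨γ, hγ, h⟩ := himg q
    exact ⟨(e γ).1, ⟨⟨γ, hγ⟩, rfl⟩, h⟩
  rw [hval.closure_eq_preimage_closure_image]
  exact closure_mono hsub (hRAW ⟨x, rfl⟩)

/-- The two steps combined: density of `Γ · ιA(TA) · ιf(Gf)` from the dictionary (`e`, `ιf`, an inducing
realisation `val` of `G∞` with its rational points `ρ`) and the ambient approximation conclusion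
`range val ⊆ closure (range ρ)`. [folklore] -/
theorem dense_of_realApproximation (e : G ≃ₜ* Ginf × Gf) (Γ : Subgroup G) (ιf : Gf →* G)
    (hιf : ∀ k : Gf, e (ιf k) = (1, k))
    {M ΓQ : Type*} [TopologicalSpace M] (val : Ginf → M) (hval : Topology.IsInducing val)
    (ρ : ΓQ → M) (himg : ∀ q, ∃ γ ∈ Γ, val (e γ).1 = ρ q)
    (hRAW : range val ⊆ closure (range ρ))
    {TA : Type*} (ιA : TA → G) (t₀ : TA) :
    Dense {g : G | ∃ γ ∈ Γ, ∃ (t : TA) (k : Gf), g = γ * ιA t * ιf k} :=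
  dense_of_denseRange_fst e Γ ιf hιf (denseRange_fst_of_isInducing e Γ val hval ρ himg hRAW) ιA t₀

end Dictionary

end DenseOrbit

end Literature.Topology.Algebra
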